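import Literature.AnabelianGeometry.EtaleTheta.SettingModelChiTate2
import Literature.AnabelianGeometry.EtaleTheta.SettingModelCyclotomicCharacter
import Literature.AnabelianGeometry.EtaleTheta.SettingModelKummerCocycleQ
import HarnessLib

/-!
# The Tate-twist half of `IsTateOrigin` HOLDS at the χ-twisted model at EVERY level `N`; only the Kummer conjunct fails

abc-iut cell, layer L2, R78 cluster (χ-TWISTED root model of [EtTh] §1, integrator abc-iut-L6-d6), seat abc-iut-w5-d051
(gen 3; author of the clause text TM of abc-iut-L2-t6's `ThetaSetting.IsTateOrigin`). Mochizuki, *The étale theta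
function …*, Publ. RIMS **45** (2009) [EtTh], §1 p. 13 [cite: MochizukiEtTh2009, §1 p.13]: «`(Δ^tp_Y)^ell ≅ Ẑ(1)`»,
«`Δ^tp_Y/Δ^tp_{Y_N} ≅ ℤ/Nℤ(1)`».

`SettingModelChiOriginProfile.modelχ_not_isTateOrigin` refutes the full clause `IsTateOrigin.tate` at
`ThetaSetting.modelχ p` (level `3`, through the KUMMER conjunct (c): the `a`-axis is untwisted). This file shows that
the other conjuncts — (a) cyclicity of `(Δ^tp_Y)^ell/N` on `ȳ₁ = (inl b)^ell`, (a′) `ȳ₁^k ∈ N·(Δ^tp_Y)^ell ↔ N ∣ k`,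
(b) the Tate twist `(g y g⁻¹)^ell ≡ (y^ell)^{χ_N(σ)}` — HOLD at `modelχ` for EVERY `N` (`modelχ_tate_twist`): the stage-1
model carries the cyclotomic `Ẑ(1)`-structure of `(Δ^tp_Y)^ell` in full, and `IsTateOrigin` fails there ONLY through the
extension class. Tools (general `N`; the `N := 2` case is `SettingModelChiTate2`): the `N`-th POWER CRITERION
`toEll_inl_mem_ellPowersY_modelχ` («`Ker(Ẑ → ℤ/N) = Ẑ^N`», `ZHatLevel.level_eq_one_iff_exists_pow`) and its converse
`exists_coords_of_mem_ellPowersY_modelχ` (closure induction); `χ_N(σ) = k` from `σ ζ_N = ζ_N^k` is abc-iut-w5-d091's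
`levelChar_chi_eq_of_isPrimitiveRoot`; `ζ_N` is abc-iut-L2-t5's chosen generator `cycGen`.

PROOF-ONLY (no definition, no named fact). Semi-synthetic model = consistency evidence only; nothing of [EtTh] is asserted;
no side is taken on [IUTchIII] Cor. 3.12; typed ≠ proved.
-/

noncomputable section

namespace Literature.AnabelianGeometry.EtaleTheta.SettingModel

open Literature.AnabelianGeometry.SemiGraphs Thm16Sub Function Topology

section Model

variable (p : ℕ) [Fact p.Prime]

/-! ### 2. The `N`-th power criterion -/

/-- **POWER CRITERION.** If `ê(pr₁ q) = 1` and `ê_b(pr₁ q)` dies in `ℤ/N`, then `(inl q)^ell ∈ N·(Δ^tp_Y)^ell`: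
`ê_b(pr₁ q) = t^N` in `Ẑ` («`Ker(Ẑ → ℤ/N) = Ẑ^N`») and `(inl q)^ell = ((inl b^t)^ell)^N`. [cite: MochizukiEtTh2009, §1 p.13] -/
theorem toEll_inl_mem_ellPowersY_modelχ (N : ℕ+) {q : Gfp} (hx : eHat (gfpFst q) = 1)
    (hy : ZHatLevel.level N (eHatB (gfpFst q)) = 1) :
    toEll (ThetaSetting.modelχ p) (SemidirectProduct.inl q) ∈ ellPowersY (ThetaSetting.modelχ p) N := by
  obtain ⟨t, ht⟩ := (ZHatLevel.level_eq_one_iff_exists_pow N _).mp hy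
  set w : PiTpχ p := SemidirectProduct.inl (bPowGfp t) with hw
  have hwY : w ∈ (ThetaSetting.modelχ p).DtpY := inl_bPowGfp_mem_dtpY p t
  have heq : toEll (ThetaSetting.modelχ p) (SemidirectProduct.inl q) =
      toEll (ThetaSetting.modelχ p) w ^ (N : ℕ) := by
    rw [← map_pow, eq_comm, toEll_modelχ_eq_iff, hw, ← map_pow, ← map_inv, ← map_mul, inl_mem_ellKerχ_iff,
      map_mul, map_inv, map_pow, gfpFst_bPowGfp, map_mul, map_mul, map_inv, map_inv, map_pow, map_pow,
      eHat_bPow, eHatB_bPow, hx, ht, one_pow, inv_one, one_mul, inv_mul_cancel]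
    exact ⟨rfl, rfl⟩
  rw [heq]
  exact Subgroup.subset_closure ⟨toEll (ThetaSetting.modelχ p) w, ⟨w, hwY, rfl⟩, rfl⟩

/-- **Converse bookkeeping**: every element of `N·(Δ^tp_Y)^ell` is `(inl q)^ell` for some `q` with `pr₂ q = 0` and
`ê_b(pr₁ q) ≡ 0 (N)` (closure induction: products and inverses of `N`-th powers of classes of `inl`'s).
[cite: MochizukiEtTh2009, §1 p.13] -/
theorem exists_coords_of_mem_ellPowersY_modelχ (N : ℕ+) {e : (ThetaSetting.modelχ p).GtpEll}
    (he : e ∈ ellPowersY (ThetaSetting.modelχ p) N) :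
    ∃ q : Gfp, gfpSnd q = 1 ∧ e = toEll (ThetaSetting.modelχ p) (SemidirectProduct.inl q) ∧
      ZHatLevel.level N (eHatB (gfpFst q)) = 1 := by
  set D := ThetaSetting.modelχ p with hD
  refine Subgroup.closure_induction (p := fun e _ => ∃ q : Gfp, gfpSnd q = 1 ∧
      e = toEll D (SemidirectProduct.inl q) ∧ ZHatLevel.level N (eHatB (gfpFst q)) = 1) ?_ ?_ ?_ ?_ he
  · -- generators `ȳ^N`, `y ∈ Δ^tp_Y`
    rintro _ ⟨_, ⟨y, hy, rfl⟩, rfl⟩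
    obtain ⟨hyr, hys, -⟩ := right_eq_one_and_eHat_eq_one_of_mem_dtpY p hy
    refine ⟨y.left ^ (N : ℕ), by rw [map_pow, hys, one_pow], ?_, ?_⟩
    · change toEll D y ^ (N : ℕ) = _
      rw [← map_pow (toEll D)]
      congr 1
      conv_lhs => rw [eq_inl_of_right_eq_one hyr]
      rw [← map_pow]
    · rw [map_pow, map_pow, ZHatLevel.level_pow_self]
  · exact ⟨1, map_one _, by rw [map_one, map_one], by rw [map_one, map_one, map_one]⟩
  · rintro e₁ e₂ - - ⟨q₁, hq₁, rfl, hl₁⟩ ⟨q₂, hq₂, rfl, hl₂⟩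
    refine ⟨q₁ * q₂, by rw [map_mul, hq₁, hq₂, mul_one], by rw [← map_mul, ← map_mul], ?_⟩
    rw [map_mul, map_mul, map_mul, hl₁, hl₂, mul_one]
  · rintro e - ⟨q, hq, rfl, hl⟩
    refine ⟨q⁻¹, by rw [map_inv, hq, inv_one], by rw [← map_inv, ← map_inv], ?_⟩
    rw [map_inv, map_inv, map_inv, hl, inv_one]

/-! ### 3. The Tate-twist half of `IsTateOrigin` at the χ-model, every level -/

/-- An auxiliary algebraic identity: `ê_b(pr₁(σ·q)) = χ(σ)(ê_b(pr₁ q))` at stage 1 (abc-iut-w5-d171's `eHatB_twist`).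
[cite: MochizukiEtTh2009, §1 p.13] -/
theorem eHatB_gfpFst_actχ (σ : GQp p) (q : Gfp) : eHatB (gfpFst (actχ p σ q)) = chi p σ (eHatB (gfpFst q)) := by
  rw [actχ_apply, gfpFst_twistGfp, eHatB_twist]

/-- `ê(pr₁(σ·q)) = ê(pr₁ q)` at stage 1. [cite: MochizukiEtTh2009, §1 p.13] -/
theorem eHat_gfpFst_actχ (σ : GQp p) (q : Gfp) : eHat (gfpFst (actχ p σ q)) = eHat (gfpFst q) := by
  rw [actχ_apply, gfpFst_twistGfp, eHat_twist]

/-- **The Tate-twist half of `IsTateOrigin` HOLDS at the χ-model at EVERY level `N`**: with `y₁ = inl b` and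
`ζ = ζ_N` (abc-iut-L2-t5's `cycGen`), (a) `(Δ^tp_Y)^ell/N` is cyclic on `ȳ₁`, (a′) `ȳ₁^k ∈ N·(Δ^tp_Y)^ell ↔ N ∣ k`,
(b) `(g y g⁻¹)^ell · (y^ell)^{-k} ∈ N·(Δ^tp_Y)^ell` whenever `aug(g) ζ = ζ^k` — only the Kummer conjunct (c) of
`IsTateOrigin.tate` fails at `modelχ` (`modelχ_not_isTateOrigin`). [cite: MochizukiEtTh2009, §1 p.13] -/
theorem modelχ_tate_twist (N : ℕ+) :
    ∃ (y₁ : (ThetaSetting.modelχ p).PiTemp) (ζ : PadicAlgCl p),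
      y₁ ∈ (ThetaSetting.modelχ p).DtpY ∧ IsPrimitiveRoot ζ (N : ℕ) ∧
      (∀ y : (ThetaSetting.modelχ p).PiTemp, y ∈ (ThetaSetting.modelχ p).DtpY → ∃ k : ℕ,
        toEll (ThetaSetting.modelχ p) y * (toEll (ThetaSetting.modelχ p) y₁ ^ k)⁻¹ ∈
          ellPowersY (ThetaSetting.modelχ p) N) ∧
      (∀ k : ℕ, toEll (ThetaSetting.modelχ p) y₁ ^ k ∈ ellPowersY (ThetaSetting.modelχ p) N ↔ (N : ℕ) ∣ k) ∧
      (∀ (g : (ThetaSetting.modelχ p).PiTemp) (k : ℕ), (ThetaSetting.modelχ p).aug g ζ = ζ ^ k →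
        ∀ y : (ThetaSetting.modelχ p).PiTemp, y ∈ (ThetaSetting.modelχ p).DtpY →
          toEll (ThetaSetting.modelχ p) (g * y * g⁻¹) * (toEll (ThetaSetting.modelχ p) y ^ k)⁻¹ ∈
            ellPowersY (ThetaSetting.modelχ p) N) := by
  set D := ThetaSetting.modelχ p with hD
  haveI : NeZero (N : ℕ) := ⟨N.ne_zero⟩
  -- the data
  let bG : Gfp := bPowGfp (iotaZ (Multiplicative.ofAdd 1))
  let y₁ : D.PiTemp := (SemidirectProduct.inl bG : PiTpχ p)
  let ζ : PadicAlgCl p := (((cycGen p : ℕ+ → (PadicAlgCl p)ˣ) N : (PadicAlgCl p)ˣ) : PadicAlgCl p)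
  have hζ : IsPrimitiveRoot ζ (N : ℕ) := isPrimitiveRoot_coe_cycGen p N
  have hbG_x : eHat (gfpFst bG) = 1 := by rw [gfpFst_bPowGfp, eHat_bPow]
  have hbG_y : eHatB (gfpFst bG) = iotaZ (Multiplicative.ofAdd 1) := by rw [gfpFst_bPowGfp, eHatB_bPow]
  have hy₁ : y₁ ∈ D.DtpY := inl_bPowGfp_mem_dtpY p _
  -- the level-`N` character
  let lev : ZH →* Multiplicative (ZMod N) := ZHatLevel.level N
  have hlev : ∀ t : ZH, lev t = ZHatLevel.level N t := fun _ => rfl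
  have hlev_one : lev (iotaZ (Multiplicative.ofAdd 1)) = Multiplicative.ofAdd 1 := by
    rw [hlev, iotaZ_one_eq, ZHatLevel.level_eta, Int.cast_one]
  have hlev_bG : lev (eHatB (gfpFst bG)) = Multiplicative.ofAdd 1 := by rw [hbG_y]; exact hlev_one
  have hlev_aut : ∀ (φ : MulAut ZH) (t : ZH),
      Multiplicative.toAdd (lev (φ t)) = ZHatLevel.levelChar N φ * Multiplicative.toAdd (lev t) :=
    fun φ t => ZHatLevel.toAdd_level_aut N φ t
  refine ⟨y₁, ζ, hy₁, hζ, ?_, ?_, ?_⟩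
  · -- (a) generation: `y ≡ y₁^{ê_b(y) mod N}` modulo `N`-th powers
    intro y hy
    obtain ⟨hyr, -, hyx⟩ := right_eq_one_and_eHat_eq_one_of_mem_dtpY p hy
    set v : ZMod N := Multiplicative.toAdd (lev (eHatB (gfpFst y.left))) with hv
    refine ⟨v.val, ?_⟩
    rw [← map_pow (toEll D), ← map_inv (toEll D), ← map_mul (toEll D), eq_inl_of_right_eq_one hyr]
    change toEll D (SemidirectProduct.inl y.left * ((SemidirectProduct.inl bG : PiTpχ p) ^ v.val)⁻¹) ∈ _
    rw [← map_pow (SemidirectProduct.inl : Gfp →* PiTpχ p), ← map_inv (SemidirectProduct.inl : Gfp →* PiTpχ p),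
      ← map_mul (SemidirectProduct.inl : Gfp →* PiTpχ p)]
    refine toEll_inl_mem_ellPowersY_modelχ p N ?_ ?_
    · simp only [map_mul, map_inv, map_pow, hyx, hbG_x, one_pow, inv_one, mul_one]
    · show lev (eHatB (gfpFst (y.left * (bG ^ v.val)⁻¹))) = 1
      simp only [map_mul, map_inv, map_pow]
      rw [hlev_bG, ← ofAdd_nsmul, nsmul_eq_mul, mul_one, ZMod.natCast_zmod_val, hv, ofAdd_toAdd, mul_inv_cancel]
  · -- (a′) `ȳ₁^k ∈ N·(Δ^tp_Y)^ell ↔ N ∣ k`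
    intro k
    constructor
    · intro hk
      obtain ⟨q, -, hq, hl⟩ := exists_coords_of_mem_ellPowersY_modelχ p N hk
      rw [← map_pow (toEll D)] at hq
      change toEll D ((SemidirectProduct.inl bG : PiTpχ p) ^ k) = _ at hq
      rw [← map_pow (SemidirectProduct.inl : Gfp →* PiTpχ p), toEll_modelχ_eq_iff, ← map_inv, ← map_mul,
        inl_mem_ellKerχ_iff] at hq
      obtain ⟨-, hy⟩ := hq
      rw [map_mul, map_inv, map_pow, map_mul, map_inv, map_pow, hbG_y, inv_mul_eq_one] at hy
      -- `ê_b(q) = ι(1)^k`, so its level is `k mod N`, which is `0` by `hl`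
      have h1 : lev (iotaZ (Multiplicative.ofAdd 1) ^ k) = 1 := by rw [hy]; exact hl
      rw [map_pow, hlev_one, ← ofAdd_nsmul, nsmul_eq_mul, mul_one, ofAdd_eq_one, ZMod.natCast_eq_zero_iff] at h1
      exact h1
    · rintro ⟨m, rfl⟩
      rw [pow_mul', ← map_pow (toEll D)]
      exact Subgroup.subset_closure ⟨toEll D (y₁ ^ m), ⟨y₁ ^ m, D.DtpY.pow_mem hy₁ m, rfl⟩, rfl⟩
  · -- (b) Tate twist: `ê_b(σ·q) = χ(σ) ê_b(q)` on `Δ^tp_Y`, and `χ_N(σ) = k` when `σ ζ_N = ζ_N^k`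
    intro g k hk y hy
    have hχ : ZHatLevel.levelChar N (chi p g.right) = (k : ZMod N) :=
      levelChar_chi_eq_of_isPrimitiveRoot p g.right N hζ hk
    obtain ⟨hyr, hys, hyx⟩ := right_eq_one_and_eHat_eq_one_of_mem_dtpY p hy
    rw [← map_pow (toEll D), ← map_inv (toEll D), ← map_mul (toEll D), eq_inl_of_right_eq_one hyr,
      conj_inl_eq,
      ← map_pow (SemidirectProduct.inl : Gfp →* PiTpχ p), ← map_inv (SemidirectProduct.inl : Gfp →* PiTpχ p),
      ← map_mul (SemidirectProduct.inl : Gfp →* PiTpχ p)]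
    refine toEll_inl_mem_ellPowersY_modelχ p N ?_ ?_
    · simp only [map_mul, map_inv, map_pow, eHat_gfpFst_actχ p, hyx, one_pow, inv_one, mul_one, mul_inv_cancel]
    · show lev (eHatB (gfpFst (g.left * actχ p g.right y.left * g.left⁻¹ * (y.left ^ k)⁻¹))) = 1
      simp only [map_mul, map_inv, map_pow, eHatB_gfpFst_actχ p g.right y.left]
      -- `Multiplicative (ℤ/N)` is commutative: cancel the conjugation, then compare levels
      rw [mul_inv_cancel_comm]
      apply Multiplicative.toAdd.injective
      rw [toAdd_mul, toAdd_inv, toAdd_pow, hlev_aut, hχ, toAdd_one, nsmul_eq_mul, add_neg_cancel]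

end Model

end Literature.AnabelianGeometry.EtaleTheta.SettingModel

end
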